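import Literature.AnabelianGeometry.EtaleTheta.Discharge.Sec2OrbitEmbeddingCoeff
import HarnessLib

/-!
# [EtTh] Def 1.9 (ii) / Def 2.7 at the §1 model: "of standard type" for `ThetaOrbitData.ofEmbedding` is a
# statement about §1 objects (a cocycle of some `σ·η̈^Θ` squares to a coboundary on `D_{τ^{±1}} ∩ Π^tp_{X̲̲}`)

Mochizuki, *The Étale Theta Function …* [EtTh], Publ. RIMS 45 (2009), §1 Def 1.9 (ii) (PRIMS PDF p.29),
§2 Def 2.7 (p.41) (bib key `MochizukiEtTh2009`): "if `η̈^{Θ,ℤ}` satisfies the property that the unique value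
of maximal order of some standard set of values [at `τ`, `τ⁻¹`] is `±1`, then … of standard type".

PROOF-ONLY companion (no `def`; seat abc-iut-L2-t2) of `ThetaRootOrbits.lean` (the CONCRETE predicate
`ThetaOrbitData.IsStandardColl`: some class of the collection restricts on some `D ∈ Dtau` to a class
killed by `2`) and `ThetaRootOrbitsOfSetting.lean` (`ofEmbedding`). For `O = ofEmbedding ε hC hS` the
hypothesis `O.IsStandard` of `Cor28_i` UNFOLDS, through the cyclotome isomorphism `coeffOf : Δ_Θ ≃ top/bot`
(`Sec2OrbitEmbeddingCoeff`), to the §1-level statement: for some `σ ∈ Π^tp_X`, some continuous cocycle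
`f` representing `σ·η̈^Θ` (abc-iut-L2-t1's `ContH1`), one of the two points `y ∈ {τ, τ⁻¹}` of the
embedding and some `d₀ ∈ Δ_Θ`: `f(g)² = (toTheta g) d₀ (toTheta g)⁻¹ · d₀⁻¹` for all
`g ∈ D_y ∩ Π^tp_{X̲̲}` — `ofEmbedding_isStandard_of` (sufficiency, what a discharger of `hstd` needs) and
`ofEmbedding_isStandard_iff`. (Relating this to abc-iut-L2-t1's value-theoretic `MuTwoSetting.IsOfStandardType`
needs Prop 1.4 (ii)/(iii) and is not addressed.) HONEST FRAMING: [EtTh] is refereed; no side is taken on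
[IUTchIII] Cor 3.12; nothing beyond the displayed statements is claimed.
-/

noncomputable section

namespace Literature.AnabelianGeometry.EtaleTheta

open Literature.AnabelianGeometry.SemiGraphs ThetaCovers

universe u

namespace ThetaCovers.ThetaOrbitData

variable {p : ℕ} [Fact p.Prime] {D : ThetaSetting p} {E : D.EtaleThetaData} {l : ℕ}
  {C : E.DoubleUnderline l} {T : TemperedCoverData.{u} l} (ε : C.OrbitEmbedding T)

/-- The pointwise computation behind both directions: for `g ∈ Π^tp_Ÿ`, a function `f`, `d₀ ∈ Δ_Θ`, and
`F = transport f`, `d = coeffOf d₀` read in the cyclotome of the orbit data,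
`F(ι g)² = act(ι g)(d) · d⁻¹ ↔ f(g)² = (toTheta g)·d₀·(toTheta g)⁻¹ · d₀⁻¹`.
[cite: MochizukiEtTh2009, Def 2.7 p.41] -/
theorem transport_sq_eq_iff (hC : D.Compat) (hS : D.Sec2Hyps) (f : ↥D.GtpYdd → ↥D.DeltaTheta)
    (d₀ : ↥D.DeltaTheta) {g : D.PiTemp} (hgY : g ∈ D.GtpYdd) (hmem : ε.ι g ∈ T.PiYddtp)
    {F : ↥T.PiYddtp → (ofEmbedding ε hC hS).DeltaTheta} (hF : F = ε.transport f)
    {d : (ofEmbedding ε hC hS).DeltaTheta} (hd : d = ε.coeffOf d₀) :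
    F ⟨ε.ι g, hmem⟩ ^ 2 = (ofEmbedding ε hC hS).act (ε.ι g) d * d⁻¹ ↔
      f ⟨g, hgY⟩ ^ 2 = MulAut.conjNormal (D.toTheta g) d₀ * d₀⁻¹ := by
  subst hF hd
  haveI : ε.bot.Normal := ε.normal_bot
  obtain ⟨e, he⟩ := ε.exists_mulEquiv_coeffOf
  have hpull : ε.pull ⟨ε.ι g, hmem⟩ = ⟨g, hgY⟩ := ε.pull_ι ⟨g, hgY⟩
  have h1 : ε.transport f ⟨ε.ι g, hmem⟩ = e (f ⟨g, hgY⟩) := by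
    show ε.coeffOf (f (ε.pull ⟨ε.ι g, hmem⟩)) = _
    rw [hpull, he]
  -- the same equivalence with `ε`-typed operations (instance path through `ε.normal_bot`)
  have key : ε.transport f ⟨ε.ι g, hmem⟩ ^ 2 =
        ε.coeffOf (MulAut.conjNormal (D.toTheta g) d₀) * (ε.coeffOf d₀)⁻¹ ↔
      f ⟨g, hgY⟩ ^ 2 = MulAut.conjNormal (D.toTheta g) d₀ * d₀⁻¹ := by
    rw [h1, ← he, ← he, ← map_pow, ← map_inv, ← map_mul, e.apply_eq_iff_eq]
  have hact : (ofEmbedding ε hC hS).act (ε.ι g) (ε.coeffOf d₀) =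
      ε.coeffOf (MulAut.conjNormal (D.toTheta g) d₀) := ε.act_coeffOf hC hS g d₀
  rw [hact]
  exact ⟨fun h => key.1 h, fun h => key.2 h⟩

/-- **"Of standard type" for `ofEmbedding`, sufficiency**: if for some `σ ∈ Π^tp_X`, some continuous
cocycle `f` representing `σ·η̈^Θ`, a point `y ∈ {τ, τ⁻¹}` of the embedding and some `d₀ ∈ Δ_Θ` one has
`f(g)² = ∂d₀(g)` for all `g ∈ D_y ∩ Π^tp_{X̲̲}`, then `η̈^{Θ,ℤ×μ₂}` of `ofEmbedding ε hC hS` is of standard type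
(`ThetaOrbitData.IsStandard`). [cite: MochizukiEtTh2009, Def 2.7 p.41] -/
theorem ofEmbedding_isStandard_of (hC : D.Compat) (hS : D.Sec2Hyps) (σ : D.PiTemp)
    (f : ↥(contCocycles D.toTheta D.DeltaTheta D.GtpYdd))
    (hf : ContH1.mk f.1 f.2 =
      (haveI := hC.GtpYdd_normal; ContH1.conj D.toTheta D.DeltaTheta σ E.etaDd))
    (y : ThetaSetting.NonCuspidalPoint E.toKummerData) (hy : y = ε.tau ∨ y = ε.tauInv)
    (d₀ : ↥D.DeltaTheta)
    (h2 : ∀ (g : D.PiTemp) (hg : g ∈ y.Dpt ⊓ C.Huu),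
      f.1 ⟨g, y.Dpt_le (Subgroup.mem_inf.1 hg).1⟩ ^ 2 = MulAut.conjNormal (D.toTheta g) d₀ * d₀⁻¹) :
    (ofEmbedding ε hC hS).IsStandard := by
  have hD : ε.decompUU y ∈ (ofEmbedding ε hC hS).Dtau := by
    rcases hy with rfl | rfl
    · exact Or.inl rfl
    · exact Or.inr rfl
  refine ⟨ε.decompUU y, hD, ε.classOf (haveI := hC.GtpYdd_normal; ContH1.conj D.toTheta D.DeltaTheta σ E.etaDd),
    ⟨σ, Set.mem_univ σ, rfl⟩, ε.transport f.1, ⟨f, hf, rfl⟩, ε.coeffOf d₀, fun g' hg' => ?_⟩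
  obtain ⟨g, hg, rfl⟩ := Subgroup.mem_map.1 hg'
  exact (transport_sq_eq_iff ε hC hS f.1 d₀ (y.Dpt_le (Subgroup.mem_inf.1 hg).1)
    (ε.map_GtpYdd.le ⟨g, y.Dpt_le (Subgroup.mem_inf.1 hg).1, rfl⟩) rfl rfl).2 (h2 g hg)

/-- **"Of standard type" for `ofEmbedding` unfolded**: `IsStandard` holds iff the §1-level condition of
`ofEmbedding_isStandard_of` holds for some `σ, f, y ∈ {τ, τ⁻¹}, d₀`. [cite: MochizukiEtTh2009, Def 2.7 p.41] -/
theorem ofEmbedding_isStandard_iff (hC : D.Compat) (hS : D.Sec2Hyps) :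
    (ofEmbedding ε hC hS).IsStandard ↔
      ∃ (σ : D.PiTemp) (f : ↥(contCocycles D.toTheta D.DeltaTheta D.GtpYdd))
        (_ : ContH1.mk f.1 f.2 =
          (haveI := hC.GtpYdd_normal; ContH1.conj D.toTheta D.DeltaTheta σ E.etaDd))
        (y : ThetaSetting.NonCuspidalPoint E.toKummerData) (_ : y = ε.tau ∨ y = ε.tauInv)
        (d₀ : ↥D.DeltaTheta),
        ∀ (g : D.PiTemp) (hg : g ∈ y.Dpt ⊓ C.Huu),
          f.1 ⟨g, y.Dpt_le (Subgroup.mem_inf.1 hg).1⟩ ^ 2 = MulAut.conjNormal (D.toTheta g) d₀ * d₀⁻¹ := by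
  constructor
  · rintro ⟨Dy, hDy, c, ⟨σ, -, rfl⟩, η, ⟨f, hf, rfl⟩, d, hsq⟩
    -- `Dy` is one of the two decomposition groups, `d = coeffOf d₀`
    obtain ⟨y, hy, rfl⟩ : ∃ y, (y = ε.tau ∨ y = ε.tauInv) ∧ Dy = ε.decompUU y := by
      rcases hDy with h | h
      · exact ⟨ε.tau, Or.inl rfl, h⟩
      · exact ⟨ε.tauInv, Or.inr rfl, h⟩
    obtain ⟨d₀, rfl⟩ := ε.coeffOf_surjective d
    refine ⟨σ, f, hf, y, hy, d₀, fun g hg => ?_⟩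
    have hgY : g ∈ D.GtpYdd := y.Dpt_le (Subgroup.mem_inf.1 hg).1
    have hmem : ε.ι g ∈ ε.decompUU y := ⟨g, hg, rfl⟩
    exact (transport_sq_eq_iff ε hC hS f.1 d₀ hgY (ε.map_GtpYdd.le ⟨g, hgY, rfl⟩) rfl rfl).1
      (hsq (ε.ι g) hmem)
  · rintro ⟨σ, f, hf, y, hy, d₀, h2⟩
    exact ofEmbedding_isStandard_of ε hC hS σ f hf y hy d₀ h2

end ThetaCovers.ThetaOrbitData

end Literature.AnabelianGeometry.EtaleTheta

end
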